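import Literature.Computability.Cryptography.LWEPrimePowerDigitLoop
import Literature.Computability.Cryptography.LWEProductLaws
import Literature.Probability.Distributions.IndepProductLawKernels
import HarnessLib

/-!
# Laws of computations driven by independent data: coordinatewise maps, batches of kernel calls, and the digit loop (MP12, Thm. 3.1, machine bridge)

Topic `Computability/Cryptography` (LWE), grouping namespace `LWE.MP12`, sequel of
`LWEPrimePowerDigitLoop.lean` (`loopLaw step n`) and `LWEProductLaws.lean` (`iidPMF` splitting).
Proved material (no named fact) towards
`Literature.Computability.Cryptography.blprs_gapSVP_sqrt_dim_to_lwe_classical` (**pqc.S21**),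
component Thm. 2.17 = Micciancio–Peikert 2012, Thm. 3.1 (hypothesis `h₂` of
`BLPRSReduction.…_of_components`): the bridge between the MACHINE — a deterministic function of its
input samples and its coin string, every call of the randomised distinguisher reading a FRESH slice
of the coins (Arora–Barak 2009, Def. 7.1: a probabilistic machine is a deterministic machine reading a
random string) — and the phase-level laws of the analysis (`LWEPrimePowerIdeal.lean`), which draw
fresh data and query a KERNEL `K u : PMF Bool`.

* `iidPMF_map_pi` — applying `gᵢ` to the `i`-th of `n` iid samples gives the independent family
  `indepLaw n (μ.map ∘ g)`; `iidPMF_succ_snoc` — an iid `(n+1)`-tuple is an iid `n`-tuple with a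
  fresh last coordinate.
* **`prodLaw_iidPMF_map_driven`** — ONE BATCH OF CALLS: if the queries `qry dat i` are computed from
  data `dat ∼ P` and the `i`-th answer is `f (qry dat i) cᵢ` with iid coins `cᵢ ∼ μ` independent of
  the data, then the outcome `out dat answers` has the law `P.bind (dat ↦ (indepLaw n (K ∘ qry dat)).map (out dat))`
  with the kernel `K u = μ.map (f u)` — the answers are independent draws of the kernel at the queries.
* `loopDet`, **`iidPMF_map_loopDet`** — THE ADAPTIVE LOOP: the digit loop whose round `i` computes its
  verdicts deterministically from the round's fresh data `datᵢ` (iid `∼ P`) and the state `L` has the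
  law `loopLaw (fun i L ↦ P.map (stepS · i L)) n` of `LWEPrimePowerDigitLoop.lean`.

## References

* D. Micciancio, C. Peikert, *Trapdoors for lattices: simpler, tighter, faster, smaller*, EUROCRYPT 2012,
  LNCS 7237; full version IACR ePrint 2011/501, §3, proof of Thm. 3.1, pp. 15–16. [MicciancioPeikert2012]
* S. Arora, B. Barak, *Computational Complexity: A Modern Approach*, CUP 2009, Def. 7.1 (probabilistic
  machines read a random string). [AroraBarak2009]
-/

noncomputable section

open scoped ENNReal

namespace Literature.Computability.Cryptography

namespace LWE

namespace MP12

open Literature.Probability.Distributions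

/-! ### Coordinatewise maps of iid tuples -/

section Pi

variable {α β : Type}

/-- **Applying `gᵢ` to the `i`-th coordinate of an iid tuple gives the independent family of the
mapped laws.** [folklore] -/
theorem iidPMF_map_pi (μ : PMF α) : ∀ (n : ℕ) (g : Fin n → α → β),
    (iidPMF μ n).map (fun v i => g i (v i)) = indepLaw n fun i => μ.map (g i)
  | 0, g => by
    rw [iidPMF_zero, PMF.pure_map, indepLaw_zero]
    congr 1
    funext i
    exact i.elim0
  | n + 1, g => by
    rw [iidPMF_succ, indepLaw_succ, PMF.map_bind, PMF.bind_map, ← iidPMF_map_pi μ n (fun i => g i.succ)]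
    refine congrArg _ (funext fun x => ?_)
    simp only [Function.comp_apply, PMF.map_comp]
    congr 1
    funext v
    simp only [Function.comp_apply]
    funext i
    refine Fin.cases ?_ (fun j => ?_) i <;> simp

/-- **An iid `(n+1)`-tuple is an iid `n`-tuple with a fresh LAST coordinate** (`Fin.snoc`).
[folklore] -/
theorem iidPMF_succ_snoc (μ : PMF α) (n : ℕ) :
    iidPMF μ (n + 1) = (iidPMF μ n).bind fun v => μ.map fun x => Fin.snoc v x := by
  classical
  ext w
  rw [iidPMF_apply', PMF.bind_apply]
  have hpt : ∀ v : Fin n → α, (iidPMF μ n) v * (μ.map fun x => (Fin.snoc v x : Fin (n + 1) → α)) w =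
      if v = Fin.init w then (∏ i : Fin n, μ (w (Fin.castSucc i))) * μ (w (Fin.last n)) else 0 := by
    intro v
    split_ifs with hv
    · subst hv
      rw [iidPMF_apply']
      congr 1
      have hinj : Function.Injective fun x : α => (Fin.snoc (Fin.init w) x : Fin (n + 1) → α) := by
        intro x y hxy
        have := congrFun hxy (Fin.last n)
        simpa using this
      have h := pmf_map_apply_of_injective μ hinj (w (Fin.last n))
      rwa [Fin.snoc_init_self] at h
    · rw [PMF.map_apply]
      convert mul_zero _
      refine ENNReal.tsum_eq_zero.2 fun x => ?_
      rw [if_neg]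
      intro h
      apply hv
      rw [h, Fin.init_snoc]
  simp_rw [hpt]
  rw [tsum_ite_eq, Fin.prod_univ_castSucc]

end Pi

/-! ### One batch of kernel calls driven by data and coins -/

section Batch

variable {D C Qu σ : Type}

/-- **One batch of calls.** Data `dat ∼ P`, iid coins `cᵢ ∼ μ` independent of it, queries
`qry dat i`, answers `f (qry dat i) cᵢ`, outcome `out dat answers`: the outcome's law is that of
drawing the data, then INDEPENDENT answers of the kernel `K u = μ.map (f u)` at the queries.
[cite: AroraBarak2009, Def. 7.1] -/
theorem prodLaw_iidPMF_map_driven (P : PMF D) (μ : PMF C) (n : ℕ) (qry : D → Fin n → Qu) (f : Qu → C → Bool)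
    (out : D → (Fin n → Bool) → σ) :
    (prodLaw P (iidPMF μ n)).map (fun x => out x.1 fun i => f (qry x.1 i) (x.2 i)) =
      P.bind fun dat => (indepLaw n fun i => μ.map (f (qry dat i))).map (out dat) := by
  rw [prodLaw, PMF.map_bind]
  refine congrArg _ (funext fun dat => ?_)
  rw [PMF.map_comp, ← iidPMF_map_pi μ n (fun i c => f (qry dat i) c), PMF.map_comp]
  rfl

end Batch

/-! ### The digit loop driven by per-round data -/

section Loop

variable {p : ℕ} {RD : Type}

/-- **The digit loop driven by per-round data**: round `i < n` computes its verdicts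
`stepS (dats i) i L` from the round's data and the state and adds `digitOf · pⁱ`; rounds `≥ n` idle.
[cite: MicciancioPeikert2012, Thm. 3.1 proof (p. 16)] -/
def loopDet (stepS : RD → ℕ → ℕ → (Fin p → Bool)) {n : ℕ} (dats : Fin n → RD) : ℕ → ℕ
  | 0 => 0
  | i + 1 => if h : i < n then loopDet stepS dats i + digitOf (stepS (dats ⟨i, h⟩) i (loopDet stepS dats i)) * p ^ i
      else loopDet stepS dats i

variable (stepS : RD → ℕ → ℕ → (Fin p → Bool))

/-- The first `k ≤ n` rounds do not read a further last datum. [folklore] -/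
theorem loopDet_snoc {n : ℕ} (v : Fin n → RD) (x : RD) : ∀ {k : ℕ}, k ≤ n →
    loopDet stepS (Fin.snoc v x : Fin (n + 1) → RD) k = loopDet stepS v k
  | 0, _ => rfl
  | k + 1, hk => by
    have hk' : k < n := hk
    simp only [loopDet, dif_pos hk', dif_pos (Nat.lt_succ_of_lt hk'), loopDet_snoc v x hk'.le]
    congr 3
    have : (⟨k, Nat.lt_succ_of_lt hk'⟩ : Fin (n + 1)) = Fin.castSucc ⟨k, hk'⟩ := rfl
    rw [this, Fin.snoc_castSucc]

/-- Round `n` of `n + 1` reads the last datum. [folklore] -/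
theorem loopDet_snoc_succ {n : ℕ} (v : Fin n → RD) (x : RD) :
    loopDet stepS (Fin.snoc v x : Fin (n + 1) → RD) (n + 1) =
      loopDet stepS v n + digitOf (stepS x n (loopDet stepS v n)) * p ^ n := by
  simp only [loopDet, dif_pos (Nat.lt_succ_self n), loopDet_snoc stepS v x le_rfl]
  congr 3
  have : (⟨n, Nat.lt_succ_self n⟩ : Fin (n + 1)) = Fin.last n := rfl
  rw [this, Fin.snoc_last]

/-- **The driven digit loop has the law `loopLaw`** of the round laws `P.map (stepS · i L)`, when the
rounds' data are iid `∼ P`. [cite: MicciancioPeikert2012, Thm. 3.1 proof (p. 16)] -/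
theorem iidPMF_map_loopDet (P : PMF RD) : ∀ n : ℕ,
    (iidPMF P n).map (fun dats => loopDet stepS dats n) = loopLaw (fun i L => P.map fun d => stepS d i L) n
  | 0 => by
    rw [iidPMF_zero, PMF.pure_map]
    rfl
  | n + 1 => by
    rw [iidPMF_succ_snoc, PMF.map_bind, loopLaw, ← iidPMF_map_loopDet P n, PMF.bind_map]
    refine congrArg _ (funext fun v => ?_)
    simp only [Function.comp_apply, Function.comp_def, PMF.map_comp, loopDet_snoc_succ]

end Loop

end MP12

end LWE

end Literature.Computability.Cryptography

end
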